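import Mathlib
import Literature.Probability.RandomPlanarGeometry.HexSAW
import Summits.CriticalPhenomena.SAWScalingLimit.Theses.SAWMassiveIsingTilt
import Summits.CriticalPhenomena.SAWScalingLimit.Theorems.SAWMassiveIsingTiltDefs
import Summits.CriticalPhenomena.SAWScalingLimit.Theorems.SAWMassiveIsingTiltCriticalCurveContinuityReductions
import Summits.CriticalPhenomena.SAWScalingLimit.Theorems.SAWMassiveIsingTiltTiltLawBasic
import Summits.CriticalPhenomena.SAWScalingLimit.Theorems.SAWMassiveIsingTiltCriticalCurveContinuityHasDerivAtWeightedAverage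
import Summits.CriticalPhenomena.SAWScalingLimit.Theorems.SAWMassiveIsingTiltCriticalCurveContinuityDifferentiableZloop

/-!
# The finite-`δ` score calculus of the tilted interface family (route `SAWMassiveIsingTilt`)

Route `SAWMassiveIsingTilt` of `CriticalPhenomena/SAWScalingLimit`; lead prover (c2) of the line
`registered` of the crux `CriticalCurveContinuity` (stmt-CriticalPhenomena-7686), cycle 2. Objects
(`Zloop`, `tiltLaw`, `SameLimit`) are those of `Theorems/SAWMassiveIsingTiltDefs.lean`.

The crux's informal mechanism ("the scaling limit of `𝔓_{x_c(y),y}` is constant in `y`: score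
decoupling `Cov_y(f(γ), ∂_y log Zloop(Ω_δ∖γ; y)) → 0`, the `y`-score being a fugacity
renormalisation plus an irrelevant finite-range remainder") is made precise here at FINITE mesh:

* `hasDerivAt_tiltExpectation` — **the `y`-derivative of a tilted expectation along a curve is the
  score covariance**: for a bounded domain, a nonzero mesh, joined endpoints, a differentiable curve
  `xc` with `xc y > 0` and `y ≥ 0`, and any function `g` of the walk,
  `d/dt|_{t=y} ∫ g d𝔓^δ_{xc t, t} = ∫ g·s_y d𝔓 − (∫ g d𝔓)(∫ s_y d𝔓)`, `𝔓 = 𝔓^δ_{xc y, y}`, with the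
  `y`-SCORE `s_y(γ) = ℓ(γ)·xc'(y)/xc(y) + Zloop'(Ω_δ∖γ; y)/Zloop(Ω_δ∖γ; y)` — the logarithmic
  derivative along the curve of the tilted weight `xc(y)^{ℓ(γ)} Zloop(Ω_δ∖γ; y)` (its first term is
  the fugacity renormalisation, its second the bath's energy-like field seen from the walk). Proof:
  expectations are finite weighted averages (`integral_tiltLaw_eq_sum_div`), the weights are positive
  near `y` (`one_le_zloop`, continuity), and the two landed calculus lemmas
  `hasDerivAt_weightedAverage`, `differentiable_zloop` (wave 1 of the line).
* `constancy_of_scoreDecoupling` — **score decoupling ⇒ constancy along the curve**: if along a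
  differentiable positive curve `xc` through the SAW corner the score covariance of every bounded
  continuous functional of the interface is `o(1)` as `δ → 0⁺` uniformly on compacts of `[0, y_c)`
  (the line's stub `stub_scoreDecoupling`, here a HYPOTHESIS), then the tilted interface laws along
  the curve are asymptotically `y`-independent (`SameLimit (xc y) y (xc y') y'`, the v3 stub
  `stub_constancyAlongCurve`) — mean-value inequality on `[0, max y y']`, eventually in `δ`.
* `deriv_zloop_zero`, `score_eq_zero_at_corner` — the SAW corner is flat to first order: no even
  subgraph has exactly one edge (`card_ne_one_of_even`), so `∂_y Zloop(Ω_δ, S; 0) = 0` and, for a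
  curve with `xc'(0) = 0`, the `y`-score vanishes identically at `y = 0` (the score covariance of
  the line's stub is exactly `0` on the compact `{0}`, at every mesh).
* `oneClassOnCriticalCurve_of_scoreDecoupling_of_hexSAW`,
  `criticalCurveContinuity_of_scoreDecoupling_of_windowToCorner` — the compositions with the landed
  reductions: score decoupling and DCS Conjecture 1 (resp. the corner landing
  `MassiveWindowSLE → HexSAWScalingLimit`) give the route target (resp. the crux), by name.

No statement of the line is asserted: score decoupling and `HexSAWScalingLimit` (a registered OPEN
conjecture) appear only as hypotheses.
-/

noncomputable section

open MeasureTheory Filter Topology Set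
open scoped NNReal ENNReal BoundedContinuousFunction
open Literature.Probability Literature.Probability.LatticeModels
  Literature.Probability.RandomPlanarGeometry
open Summit.CriticalPhenomena.SAWScalingLimit.Theses.SAWMassiveIsingTilt
open Summit.CriticalPhenomena.SAWScalingLimit.Theorems.ObservableToSLE.Negative (finite_hexDomainSAW)

namespace Summit.CriticalPhenomena.SAWScalingLimit.Theorems.SAWMassiveIsingTilt

/-! ### The derivative of a tilted expectation is the score covariance -/

/-- **The `y`-derivative of a tilted expectation along a curve is the score covariance.** For a
bounded domain, a nonzero mesh, joined endpoints, a differentiable curve `xc` with `xc y > 0` and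
`y ≥ 0`: `d/dt|_{t=y} ∫ g d𝔓^δ_{xc t, t} = ∫ g·s_y d𝔓 − (∫ g d𝔓)(∫ s_y d𝔓)`, `𝔓 = 𝔓^δ_{xc y, y}`,
`s_y(γ) = ℓ(γ)·xc'(y)/xc(y) + Zloop'(Ω_δ∖γ; y)/Zloop(Ω_δ∖γ; y)`. -/
theorem hasDerivAt_tiltExpectation : ∀ {Ω : Set ℂ}, Bornology.IsBounded Ω → ∀ {δ : ℝ}, δ ≠ 0 →
    ∀ {a b : HexVertex}, (SAW.hexDomainGraph Ω δ).Reachable a b → ∀ {xc : ℝ → ℝ}, Differentiable ℝ xc →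
    ∀ {y : ℝ}, 0 ≤ y → 0 < xc y → ∀ g : SAW.HexDomainSAW Ω δ a b → ℝ,
    HasDerivAt (fun t => ∫ γ, g γ ∂(tiltLaw Ω δ (xc t) t a b))
      ((∫ γ, g γ * ((γ.vertexCount : ℝ) * deriv xc y / xc y +
            deriv (fun t => Zloop (SAW.hexDomainGraph Ω δ) {v | v ∉ γ.walk.support} t) y /
              Zloop (SAW.hexDomainGraph Ω δ) {v | v ∉ γ.walk.support} y)
          ∂(tiltLaw Ω δ (xc y) y a b)) -
        (∫ γ, g γ ∂(tiltLaw Ω δ (xc y) y a b)) *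
          ∫ γ, ((γ.vertexCount : ℝ) * deriv xc y / xc y +
            deriv (fun t => Zloop (SAW.hexDomainGraph Ω δ) {v | v ∉ γ.walk.support} t) y /
              Zloop (SAW.hexDomainGraph Ω δ) {v | v ∉ γ.walk.support} y)
          ∂(tiltLaw Ω δ (xc y) y a b)) y := by
  intro Ω hΩ δ hδ a b hab xc hxc y hy hxcy g
  classical
  haveI := finite_hexDomainSAW hΩ hδ a b
  haveI := Fintype.ofFinite (SAW.HexDomainSAW Ω δ a b)
  obtain ⟨p⟩ := hab
  haveI : Nonempty (SAW.HexDomainSAW Ω δ a b) := ⟨⟨p.toPath.1, p.toPath.2⟩⟩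
  -- notation: `Z γ` the bath factor of `γ`, `w γ` the tilted weight along the curve, `w' γ` its
  -- derivative at `y`, `s γ` the score
  set H := SAW.hexDomainGraph Ω δ with hH
  let Z : SAW.HexDomainSAW Ω δ a b → ℝ → ℝ := fun γ t => Zloop H {v | v ∉ γ.walk.support} t
  let w : SAW.HexDomainSAW Ω δ a b → ℝ → ℝ := fun γ t => xc t ^ γ.vertexCount * Z γ t
  let w' : SAW.HexDomainSAW Ω δ a b → ℝ := fun γ =>
    (γ.vertexCount : ℝ) * xc y ^ (γ.vertexCount - 1) * deriv xc y * Z γ y +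
      xc y ^ γ.vertexCount * deriv (Z γ) y
  let s : SAW.HexDomainSAW Ω δ a b → ℝ := fun γ =>
    (γ.vertexCount : ℝ) * deriv xc y / xc y + deriv (Z γ) y / Z γ y
  -- differentiability of the weights (`differentiable_zloop`, chain and product rules)
  have hZd : ∀ γ, HasDerivAt (Z γ) (deriv (Z γ) y) y := fun γ =>
    ((differentiable_zloop hΩ hδ {v | v ∉ γ.walk.support}).differentiableAt).hasDerivAt
  have hw : ∀ γ, HasDerivAt (w γ) (w' γ) y := fun γ =>
    (((hxc y).hasDerivAt).fun_pow γ.vertexCount).mul (hZd γ)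
  -- positivity of the weights at `y` (`one_le_zloop`) and near `y` (continuity)
  have hZpos : ∀ γ, 0 < Z γ y := fun γ =>
    lt_of_lt_of_le one_pos (one_le_zloop hΩ hδ hy _)
  have hwpos : ∀ γ, 0 < w γ y := fun γ => mul_pos (pow_pos hxcy _) (hZpos γ)
  have hev : ∀ᶠ t in 𝓝 y, ∀ γ, 0 ≤ w γ t := by
    have h1 : ∀ᶠ t in 𝓝 y, 0 < xc t :=
      (hxc y).continuousAt.eventually (lt_mem_nhds hxcy)
    have h2 : ∀ᶠ t in 𝓝 y, ∀ γ, 0 < Z γ t :=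
      eventually_all.2 fun γ => (hZd γ).continuousAt.eventually (lt_mem_nhds (hZpos γ))
    filter_upwards [h1, h2] with t ht1 ht2
    exact fun γ => (mul_pos (pow_pos ht1 _) (ht2 γ)).le
  -- near `y` the tilted expectation is the finite weighted average (`integral_tiltLaw_eq_sum_div`)
  have heq : (fun t => ∫ γ, g γ ∂(tiltLaw Ω δ (xc t) t a b)) =ᶠ[𝓝 y]
      fun t => (∑ γ, w γ t * g γ) / ∑ γ, w γ t := by
    filter_upwards [hev] with t ht
    exact integral_tiltLaw_eq_sum_div ht g
  -- derivative of the weighted average (`hasDerivAt_weightedAverage`)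
  have hder : HasDerivAt (fun t => ∫ γ, g γ ∂(tiltLaw Ω δ (xc t) t a b))
      ((∑ γ, w γ y * (g γ * (w' γ / w γ y))) / (∑ γ, w γ y) -
        ((∑ γ, w γ y * g γ) / ∑ γ, w γ y) * ((∑ γ, w γ y * (w' γ / w γ y)) / ∑ γ, w γ y)) y :=
    (hasDerivAt_weightedAverage w w' g y hw hwpos).congr_of_eventuallyEq heq
  -- the logarithmic derivative of the weight is the score
  have hscore : ∀ γ, w' γ / w γ y = s γ := by
    intro γ
    have hx0 : xc y ≠ 0 := hxcy.ne'
    have hZ0 : Z γ y ≠ 0 := (hZpos γ).ne'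
    have hℓ : γ.vertexCount = γ.length + 1 := rfl
    simp only [w, w', s, hℓ, Nat.add_sub_cancel, pow_succ]
    field_simp
  have hwy : ∀ γ, 0 ≤ w γ y := fun γ => (hwpos γ).le
  rw [integral_tiltLaw_eq_sum_div hwy, integral_tiltLaw_eq_sum_div hwy,
    integral_tiltLaw_eq_sum_div hwy]
  have e1 : (∑ γ, w γ y * (g γ * (w' γ / w γ y))) = ∑ γ, w γ y * (g γ * s γ) :=
    Finset.sum_congr rfl fun γ _ => by rw [hscore γ]
  have e2 : (∑ γ, w γ y * (w' γ / w γ y)) = ∑ γ, w γ y * s γ :=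
    Finset.sum_congr rfl fun γ _ => by rw [hscore γ]
  rw [e1, e2] at hder
  exact hder

/-! ### Score decoupling ⇒ constancy along the curve -/

/-- `y_c = (√3)⁻¹ ≤ 1`. -/
theorem inv_sqrt_three_le_one : (Real.sqrt 3)⁻¹ ≤ (1 : ℝ) :=
  inv_le_one_of_one_le₀ (Real.one_le_sqrt.2 (by norm_num))

/-- **Score decoupling ⇒ constancy along the curve.** If along a differentiable positive curve
`xc` through the SAW corner the finite-`δ` score covariance of every bounded continuous functional
of the interface is `o(1)` uniformly on compacts `[0, y₁] ⊂ [0, y_c)` (the line's stub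
`stub_scoreDecoupling`, a hypothesis here), then the tilted interface laws along the curve are
asymptotically `y`-independent (v3's `stub_constancyAlongCurve`): mean-value inequality on
`[0, max y y']`, eventually in `δ`. -/
theorem constancy_of_scoreDecoupling :
    (∃ xc : ℝ → ℝ, xc 0 = SAW.hexCriticalFugacity ∧ Differentiable ℝ xc ∧
      (∀ y ∈ Set.Ico (0 : ℝ) (Real.sqrt 3)⁻¹, 0 < xc y) ∧
      ∀ (D : DobrushinDomain) (a b : ℝ → HexVertex), SAW.IsEmbEndpointApprox hexGraph hexCenter D a b →
        ∀ f : CurveClass ℂ →ᵇ ℝ, ∀ y₁ ∈ Set.Ico (0 : ℝ) (Real.sqrt 3)⁻¹, ∀ ε > (0 : ℝ),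
          ∀ᶠ δ in 𝓝[>] (0 : ℝ), ∀ y ∈ Set.Icc (0 : ℝ) y₁,
            |(∫ γ, f γ.curve * ((γ.vertexCount : ℝ) * deriv xc y / xc y +
                  deriv (fun t => Zloop (SAW.hexDomainGraph D.carrier δ) {v | v ∉ γ.walk.support} t) y /
                    Zloop (SAW.hexDomainGraph D.carrier δ) {v | v ∉ γ.walk.support} y)
                ∂(tiltLaw D.carrier δ (xc y) y (a δ) (b δ))) -
              (∫ γ, f γ.curve ∂(tiltLaw D.carrier δ (xc y) y (a δ) (b δ))) *
                ∫ γ, ((γ.vertexCount : ℝ) * deriv xc y / xc y +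
                  deriv (fun t => Zloop (SAW.hexDomainGraph D.carrier δ) {v | v ∉ γ.walk.support} t) y /
                    Zloop (SAW.hexDomainGraph D.carrier δ) {v | v ∉ γ.walk.support} y)
                ∂(tiltLaw D.carrier δ (xc y) y (a δ) (b δ))| ≤ ε) →
    ∃ xc : ℝ → ℝ, xc 0 = SAW.hexCriticalFugacity ∧
      ∀ y ∈ Set.Ico (0 : ℝ) (Real.sqrt 3)⁻¹, ∀ y' ∈ Set.Ico (0 : ℝ) (Real.sqrt 3)⁻¹,
        SameLimit (xc y) y (xc y') y' := by
  rintro ⟨xc, hxc0, hxcd, hxpos, hSD⟩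
  refine ⟨xc, hxc0, fun y hy y' hy' D a b hab f => ?_⟩
  -- the compact `[0, y₁]`, `y₁ = max y y' < y_c`
  set y₁ := max y y' with hy₁def
  have hy₁ : y₁ ∈ Set.Ico (0 : ℝ) (Real.sqrt 3)⁻¹ :=
    ⟨le_max_of_le_left hy.1, max_lt hy.2 hy'.2⟩
  have hyI : y ∈ Set.Icc (0 : ℝ) y₁ := ⟨hy.1, le_max_left _ _⟩
  have hy'I : y' ∈ Set.Icc (0 : ℝ) y₁ := ⟨hy'.1, le_max_right _ _⟩
  rw [Metric.tendsto_nhds]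
  intro ε hε
  have hcov := hSD D a b hab f y₁ hy₁ (ε / 2) (half_pos hε)
  filter_upwards [hcov, hab.reachable, self_mem_nhdsWithin] with δ hδcov hr hδpos
  have hδ : δ ≠ 0 := ne_of_gt hδpos
  -- on `[0, y₁]` the expectation is differentiable in `t` with derivative the score covariance
  have hderiv : ∀ t ∈ Set.Icc (0 : ℝ) y₁,
      HasDerivWithinAt (fun t => ∫ γ, f γ.curve ∂(tiltLaw D.carrier δ (xc t) t (a δ) (b δ)))
        ((∫ γ, f γ.curve * ((γ.vertexCount : ℝ) * deriv xc t / xc t +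
              deriv (fun u => Zloop (SAW.hexDomainGraph D.carrier δ) {v | v ∉ γ.walk.support} u) t /
                Zloop (SAW.hexDomainGraph D.carrier δ) {v | v ∉ γ.walk.support} t)
            ∂(tiltLaw D.carrier δ (xc t) t (a δ) (b δ))) -
          (∫ γ, f γ.curve ∂(tiltLaw D.carrier δ (xc t) t (a δ) (b δ))) *
            ∫ γ, ((γ.vertexCount : ℝ) * deriv xc t / xc t +
              deriv (fun u => Zloop (SAW.hexDomainGraph D.carrier δ) {v | v ∉ γ.walk.support} u) t /
                Zloop (SAW.hexDomainGraph D.carrier δ) {v | v ∉ γ.walk.support} t)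
            ∂(tiltLaw D.carrier δ (xc t) t (a δ) (b δ)))
        (Set.Icc (0 : ℝ) y₁) t := by
    intro t ht
    exact (hasDerivAt_tiltExpectation D.isBounded hδ hr hxcd ht.1
      (hxpos t ⟨ht.1, lt_of_le_of_lt ht.2 hy₁.2⟩) (fun γ => f γ.curve)).hasDerivWithinAt
  -- mean-value inequality with the uniform bound `ε / 2` on the derivative
  have hbound := Convex.norm_image_sub_le_of_norm_hasDerivWithin_le (C := ε / 2) hderiv
    (fun t ht => ?_) (convex_Icc (0 : ℝ) y₁) hy'I hyI
  · rw [Real.dist_eq, sub_zero]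
    calc |(∫ γ, f γ.curve ∂(tiltLaw D.carrier δ (xc y) y (a δ) (b δ))) -
            ∫ γ, f γ.curve ∂(tiltLaw D.carrier δ (xc y') y' (a δ) (b δ))|
          ≤ ε / 2 * ‖y - y'‖ := hbound
      _ ≤ ε / 2 * 1 := by
          refine mul_le_mul_of_nonneg_left ?_ (half_pos hε).le
          rw [Real.norm_eq_abs, abs_le]
          have h1 := inv_sqrt_three_le_one
          constructor <;> nlinarith [hy.1, hy.2, hy'.1, hy'.2]
      _ < ε := by linarith
  · rw [Real.norm_eq_abs]
    exact hδcov t ht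

/-! ### The SAW corner is flat to first order -/

/-- An even subgraph never consists of exactly one edge (its endpoints would have odd degree). -/
theorem card_ne_one_of_even {E : Finset (Sym2 HexVertex)}
    (hE : ∀ v : HexVertex, Even (E.filter (fun e => v ∈ e)).card) : E.card ≠ 1 := by
  intro h1
  obtain ⟨e, rfl⟩ := Finset.card_eq_one.1 h1
  induction e using Sym2.ind with
  | h u v =>
    have h := hE u
    rw [Finset.filter_singleton, if_pos (Sym2.mem_mk_left u v), Finset.card_singleton] at h
    exact Nat.not_even_one h

/-- **The bath switches off to first order at the SAW corner**: `∂_y Zloop(Ω_δ, S; y)|_{y=0} = 0`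
(no even subgraph has exactly one edge — on the honeycomb lattice the first loops have six —
so `Zloop(Ω_δ, S; y) = 1 + O(y²)`; in fact `1 + (#hexagons ⊆ S)·y⁶ + O(y⁸)`). -/
theorem deriv_zloop_zero {Ω : Set ℂ} (hΩ : Bornology.IsBounded Ω) {δ : ℝ} (hδ : δ ≠ 0)
    (S : Set HexVertex) : deriv (fun t => Zloop (SAW.hexDomainGraph Ω δ) S t) 0 = 0 := by
  have h : (fun t => Zloop (SAW.hexDomainGraph Ω δ) S t) =
      fun t => ∑ E ∈ (finite_setOf_evenSubgraph hΩ hδ S).toFinset, t ^ E.card :=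
    funext fun t => zloop_eq_finset_sum hΩ hδ S t
  rw [h, (HasDerivAt.fun_sum fun E _ => hasDerivAt_pow E.card (0 : ℝ)).deriv]
  refine Finset.sum_eq_zero fun E hE => ?_
  rw [Set.Finite.mem_toFinset] at hE
  have hne : E.card ≠ 1 := card_ne_one_of_even hE.2
  rcases Nat.lt_or_ge E.card 1 with h0 | h2
  · simp [Nat.lt_one_iff.1 h0]
  · have h3 : E.card - 1 ≠ 0 := by omega
    simp [zero_pow h3]

/-- **At the SAW corner the `y`-score vanishes identically for a curve flat at `0`**
(`xc'(0) = 0`, as the critical curve `x_c(y) = x_c + O(y⁶)` is): with `deriv_zloop_zero`,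
`s_0(γ) = ℓ(γ)·xc'(0)/xc(0) + Zloop'(Ω_δ∖γ; 0)/Zloop(Ω_δ∖γ; 0) = 0` for every walk and every
mesh — the score covariance of `stub_scoreDecoupling` is exactly `0` on the compact `{0}`; its
first non-trivial order in `y` is `y⁵` (the hexagons adjacent to the walk). -/
theorem score_eq_zero_at_corner {Ω : Set ℂ} (hΩ : Bornology.IsBounded Ω) {δ : ℝ} (hδ : δ ≠ 0)
    {a b : HexVertex} {xc : ℝ → ℝ} (hxc' : deriv xc 0 = 0) (γ : SAW.HexDomainSAW Ω δ a b) :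
    (γ.vertexCount : ℝ) * deriv xc 0 / xc 0 +
      deriv (fun t => Zloop (SAW.hexDomainGraph Ω δ) {v | v ∉ γ.walk.support} t) 0 /
        Zloop (SAW.hexDomainGraph Ω δ) {v | v ∉ γ.walk.support} 0 = 0 := by
  rw [hxc', deriv_zloop_zero hΩ hδ]
  simp

/-! ### Compositions with the landed reductions -/

/-- Score decoupling and DCS Conjecture 1 give the route TARGET `OneClassOnCriticalCurve` (the
massive window is not used in this direction). -/
theorem oneClassOnCriticalCurve_of_scoreDecoupling_of_hexSAW
    (hSD : ∃ xc : ℝ → ℝ, xc 0 = SAW.hexCriticalFugacity ∧ Differentiable ℝ xc ∧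
      (∀ y ∈ Set.Ico (0 : ℝ) (Real.sqrt 3)⁻¹, 0 < xc y) ∧
      ∀ (D : DobrushinDomain) (a b : ℝ → HexVertex), SAW.IsEmbEndpointApprox hexGraph hexCenter D a b →
        ∀ f : CurveClass ℂ →ᵇ ℝ, ∀ y₁ ∈ Set.Ico (0 : ℝ) (Real.sqrt 3)⁻¹, ∀ ε > (0 : ℝ),
          ∀ᶠ δ in 𝓝[>] (0 : ℝ), ∀ y ∈ Set.Icc (0 : ℝ) y₁,
            |(∫ γ, f γ.curve * ((γ.vertexCount : ℝ) * deriv xc y / xc y +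
                  deriv (fun t => Zloop (SAW.hexDomainGraph D.carrier δ) {v | v ∉ γ.walk.support} t) y /
                    Zloop (SAW.hexDomainGraph D.carrier δ) {v | v ∉ γ.walk.support} y)
                ∂(tiltLaw D.carrier δ (xc y) y (a δ) (b δ))) -
              (∫ γ, f γ.curve ∂(tiltLaw D.carrier δ (xc y) y (a δ) (b δ))) *
                ∫ γ, ((γ.vertexCount : ℝ) * deriv xc y / xc y +
                  deriv (fun t => Zloop (SAW.hexDomainGraph D.carrier δ) {v | v ∉ γ.walk.support} t) y /
                    Zloop (SAW.hexDomainGraph D.carrier δ) {v | v ∉ γ.walk.support} y)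
                ∂(tiltLaw D.carrier δ (xc y) y (a δ) (b δ))| ≤ ε)
    (hHex : SAW.HexSAWScalingLimit) : OneClassOnCriticalCurve :=
  oneClassOnCriticalCurve_of_constancy_of_hexSAW (constancy_of_scoreDecoupling hSD) hHex

/-- Score decoupling and the corner landing `MassiveWindowSLE → HexSAWScalingLimit` (the line's
parked stub `stub_windowToCorner`) give the CRUX `CriticalCurveContinuity`, by name. -/
theorem criticalCurveContinuity_of_scoreDecoupling_of_windowToCorner
    (hSD : ∃ xc : ℝ → ℝ, xc 0 = SAW.hexCriticalFugacity ∧ Differentiable ℝ xc ∧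
      (∀ y ∈ Set.Ico (0 : ℝ) (Real.sqrt 3)⁻¹, 0 < xc y) ∧
      ∀ (D : DobrushinDomain) (a b : ℝ → HexVertex), SAW.IsEmbEndpointApprox hexGraph hexCenter D a b →
        ∀ f : CurveClass ℂ →ᵇ ℝ, ∀ y₁ ∈ Set.Ico (0 : ℝ) (Real.sqrt 3)⁻¹, ∀ ε > (0 : ℝ),
          ∀ᶠ δ in 𝓝[>] (0 : ℝ), ∀ y ∈ Set.Icc (0 : ℝ) y₁,
            |(∫ γ, f γ.curve * ((γ.vertexCount : ℝ) * deriv xc y / xc y +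
                  deriv (fun t => Zloop (SAW.hexDomainGraph D.carrier δ) {v | v ∉ γ.walk.support} t) y /
                    Zloop (SAW.hexDomainGraph D.carrier δ) {v | v ∉ γ.walk.support} y)
                ∂(tiltLaw D.carrier δ (xc y) y (a δ) (b δ))) -
              (∫ γ, f γ.curve ∂(tiltLaw D.carrier δ (xc y) y (a δ) (b δ))) *
                ∫ γ, ((γ.vertexCount : ℝ) * deriv xc y / xc y +
                  deriv (fun t => Zloop (SAW.hexDomainGraph D.carrier δ) {v | v ∉ γ.walk.support} t) y /
                    Zloop (SAW.hexDomainGraph D.carrier δ) {v | v ∉ γ.walk.support} y)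
                ∂(tiltLaw D.carrier δ (xc y) y (a δ) (b δ))| ≤ ε)
    (h2 : MassiveWindowSLE → SAW.HexSAWScalingLimit) : CriticalCurveContinuity :=
  fun hMW => oneClassOnCriticalCurve_of_constancy_of_hexSAW (constancy_of_scoreDecoupling hSD) (h2 hMW)

end Summit.CriticalPhenomena.SAWScalingLimit.Theorems.SAWMassiveIsingTilt

end
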